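import Literature.NumberTheory.LocalFields.PadicMultiplicativeGroupStructure
import Mathlib.GroupTheory.SpecificGroups.Cyclic
import HarnessLib

/-!
# `ℚ_p^* ≅ ℤ × ℤ/(p−1)ℤ × ℤ_p` (`p ≠ 2`) and `ℚ_2^* ≅ ℤ × ℤ/2ℤ × ℤ_2` as group isomorphisms
# (Serre II §3.2 Thm. 2; Neukirch II (5.7)(i))

Topic `NumberTheory/LocalFields`; namespace `Literature.NumberTheory.LocalFields`. Everything here is
proved (theorems only; no definitions, no named facts). `PadicMultiplicativeGroupStructure.lean` gives
the unique factorisation `x = pⁿ·ω·(1 + p)^α` (`ωᵖ⁻¹ = 1`, `α ∈ ℤ_p`; for `p = 2`: `x = 2ⁿ·(±1)·5^α`)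
of a non-zero `p`-adic number; here we package it, as printed, into isomorphisms of groups.

J.-P. Serre, *A Course in Arithmetic*, Ch. II §3.2, Theorem 2: "If `p ≠ 2`, … the group `ℚ_p^*` is
isomorphic to `ℤ × ℤ_p × ℤ/(p−1)ℤ`. If `p = 2`, … the group `ℚ_2^*` is isomorphic to
`ℤ × ℤ_2 × ℤ/2ℤ`." J. Neukirch, *Algebraic Number Theory*, Ch. II Prop. (5.7)(i): for a local field
of characteristic `0`, `K^* ≅ ℤ ⊕ ℤ/(q−1)ℤ ⊕ ℤ/pᵃℤ ⊕ ℤ_pᵈ`, `d = [K : ℚ_p]` (here `K = ℚ_p`: `q = p`,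
`d = 1`, and `a = 0` for `p ≠ 2`, `a = 1`, `q − 1 = 1` for `p = 2`).

* §1 `exists_mulEquiv_of_existsUnique` — the map `(n, ζ, α) ↦ pⁿ·ζ·(1 + x)^α` is a homomorphism
  `ℤ × μ_k(ℤ_p) × ℤ_p → ℚ_p^*` (exponential law `(1 + x)^{α+β} = (1 + x)^α(1 + x)^β`), and it is an
  isomorphism as soon as every `y ≠ 0` factors uniquely;
  `exists_unitsMulEquiv_of_existsUnique` — then also `(ζ, α) ↦ ζ·(1 + x)^α` is an isomorphism
  `μ_k(ℤ_p) × ℤ_p → ℤ_p^×` (units are the elements with `n = 0`, by taking norms);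
* §2 `exists_mulEquiv_zpow_mul_rootOfUnity_mul_binomialPower` (`p ≠ 2`, `x = p`, `k = p − 1`) and
  `exists_mulEquiv_zpow_mul_sign_mul_five_pow` (`p = 2`, `x = 4`, `k = 2`): explicit isomorphisms
  `ℤ × μ_{p−1} × ℤ_p ≃* ℚ_p^*`, `ℤ × μ₂ × ℤ₂ ≃* ℚ_2^*`; `exists_unitsMulEquiv_rootOfUnity_mul_binomialPower`,
  `exists_unitsMulEquiv_sign_mul_five_pow`: `μ_{p−1} × ℤ_p ≃* ℤ_p^×`, `μ₂ × ℤ₂ ≃* ℤ_2^×`;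
* §3 `nonempty_rootsOfUnity_mulEquiv_zmod` — `μ_m(ℤ_p) ≅ ℤ/mℤ` for `m ∣ p − 1` (cyclic of order `m`,
  by the tree's `padicInt_exists_isPrimitiveRoot_of_dvd`); `nonempty_rootsOfUnity_two_mulEquiv_zmod`;
* §4 the printed statements `nonempty_units_padic_mulEquiv` (`ℚ_p^* ≅ ℤ × ℤ/(p−1)ℤ × ℤ_p`, `p ≠ 2`)
  and `nonempty_units_padicTwo_mulEquiv` (`ℚ_2^* ≅ ℤ × ℤ/2ℤ × ℤ_2`); for the unit groups
  `nonempty_units_padicInt_mulEquiv` (`ℤ_p^× ≅ ℤ/(p−1)ℤ × ℤ_p`, `p ≠ 2`) and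
  `nonempty_units_padicIntTwo_mulEquiv` (`ℤ_2^× ≅ ℤ/2ℤ × ℤ_2`).

(Additive groups `ℤ`, `ℤ/mℤ`, `ℤ_p` enter as `Multiplicative _`.)

## References

* J.-P. Serre, *A Course in Arithmetic*, GTM 7, Springer 1973, Ch. II §3.2 Thm. 2. [Serre1973]
* J. Neukirch, *Algebraic Number Theory*, Grundlehren 322, Springer 1999, Ch. II Prop. (5.7)(i).
  [NeukirchANT1999]
-/

noncomputable section

namespace Literature.NumberTheory.LocalFields

variable {p : ℕ} [hp : Fact p.Prime]

/-! ## §1. The homomorphism `(n, ζ, α) ↦ pⁿ·ζ·(1 + x)^α` -/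

/-- **From unique factorisation to a group isomorphism.** Let `‖x‖ < 1` and `k ≥ 1`, and suppose every
`y ∈ ℚ_p^*` is uniquely `y = pⁿ·ω·(1 + x)^α` with `n ∈ ℤ`, `ωᵏ = 1`, `α ∈ ℤ_p`. Then
`(n, ζ, α) ↦ pⁿ·ζ·(1 + x)^α` is an isomorphism of groups `ℤ × μ_k(ℤ_p) × ℤ_p ≃ ℚ_p^*` (it is a
homomorphism by the exponential law `(1 + x)^{α+β} = (1 + x)^α (1 + x)^β`).
[cite: Serre1973, Ch. II §3.2 Thm. 2 (proof)] -/
theorem exists_mulEquiv_of_existsUnique {x : ℤ_[p]} (hx : ‖x‖ < 1) {k : ℕ} [NeZero k]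
    (H : ∀ y : ℚ_[p], y ≠ 0 → ∃! t : ℤ × ℤ_[p] × ℤ_[p], t.2.1 ^ k = 1 ∧
      y = (p : ℚ_[p]) ^ t.1 * (t.2.1 : ℚ_[p]) * (PadicInt.mahlerSeries (fun n => x ^ n) t.2.2 : ℚ_[p])) :
    ∃ e : Multiplicative ℤ × (rootsOfUnity k ℤ_[p]) × Multiplicative ℤ_[p] ≃* ℚ_[p]ˣ,
      ∀ (n : ℤ) (ζ : rootsOfUnity k ℤ_[p]) (α : ℤ_[p]),
        ((e (Multiplicative.ofAdd n, ζ, Multiplicative.ofAdd α) : ℚ_[p]ˣ) : ℚ_[p]) =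
          (p : ℚ_[p]) ^ n * (((ζ : ℤ_[p]ˣ) : ℤ_[p]) : ℚ_[p]) *
            (PadicInt.mahlerSeries (fun n => x ^ n) α : ℚ_[p]) := by
  have hp0 : (p : ℚ_[p]) ≠ 0 := by exact_mod_cast hp.out.ne_zero
  have hBne : ∀ α : ℤ_[p], ((PadicInt.mahlerSeries (fun n => x ^ n) α : ℤ_[p]) : ℚ_[p]) ≠ 0 :=
    fun α => PadicInt.coe_ne_zero.2 (isUnit_binomialPower hx α).ne_zero
  have hζne : ∀ ζ : rootsOfUnity k ℤ_[p], (((ζ : ℤ_[p]ˣ) : ℤ_[p]) : ℚ_[p]) ≠ 0 :=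
    fun ζ => PadicInt.coe_ne_zero.2 (ζ : ℤ_[p]ˣ).ne_zero
  -- the value of `(n, ζ, α)` in `ℚ_p`
  set g : Multiplicative ℤ × (rootsOfUnity k ℤ_[p]) × Multiplicative ℤ_[p] → ℚ_[p] := fun t =>
    (p : ℚ_[p]) ^ t.1.toAdd * (((t.2.1 : ℤ_[p]ˣ) : ℤ_[p]) : ℚ_[p]) *
      (PadicInt.mahlerSeries (fun n => x ^ n) t.2.2.toAdd : ℚ_[p]) with hg
  have hg0 : ∀ t, g t ≠ 0 := fun t =>
    mul_ne_zero (mul_ne_zero (zpow_ne_zero _ hp0) (hζne _)) (hBne _)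
  have hgmul : ∀ s t, g (s * t) = g s * g t := by
    intro s t
    simp only [hg, Prod.fst_mul, Prod.snd_mul, toAdd_mul, Subgroup.coe_mul, Units.val_mul,
      PadicInt.coe_mul, zpow_add₀ hp0, binomialPower_add hx]
    ring
  let Φ : Multiplicative ℤ × (rootsOfUnity k ℤ_[p]) × Multiplicative ℤ_[p] →* ℚ_[p]ˣ :=
    MonoidHom.mk' (fun t => Units.mk0 (g t) (hg0 t)) (fun s t => Units.ext (by simp [hgmul]))
  have hΦ : ∀ t, ((Φ t : ℚ_[p]ˣ) : ℚ_[p]) = g t := fun t => rfl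
  have hmem : ∀ ζ : rootsOfUnity k ℤ_[p], ((ζ : ℤ_[p]ˣ) : ℤ_[p]) ^ k = 1 :=
    fun ζ => (mem_rootsOfUnity' k _).1 ζ.2
  have hinj : Function.Injective Φ := by
    intro s t hst
    have hy : g s = g t := by rw [← hΦ, ← hΦ, hst]
    obtain ⟨t₀, -, huniq⟩ := H (g s) (hg0 s)
    have hs' := huniq (s.1.toAdd, ((s.2.1 : ℤ_[p]ˣ) : ℤ_[p]), s.2.2.toAdd) ⟨hmem _, rfl⟩
    have ht' := huniq (t.1.toAdd, ((t.2.1 : ℤ_[p]ˣ) : ℤ_[p]), t.2.2.toAdd) ⟨hmem _, hy⟩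
    have hst' := hs'.trans ht'.symm
    simp only [Prod.mk.injEq] at hst'
    obtain ⟨h1, h2, h3⟩ := hst'
    exact Prod.ext (Multiplicative.toAdd.injective h1)
      (Prod.ext (Subtype.ext (Units.ext h2)) (Multiplicative.toAdd.injective h3))
  have hsurj : Function.Surjective Φ := by
    intro y
    obtain ⟨⟨n, ω, α⟩, ⟨hω, hy⟩, -⟩ := H (y : ℚ_[p]) y.ne_zero
    refine ⟨(Multiplicative.ofAdd n, rootsOfUnity.mkOfPowEq ω hω, Multiplicative.ofAdd α),
      Units.ext ?_⟩
    rw [hΦ, hy]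
    simp [hg]
  refine ⟨MulEquiv.ofBijective Φ ⟨hinj, hsurj⟩, fun n ζ α => ?_⟩
  rw [MulEquiv.ofBijective_apply, hΦ]
  simp [hg]

/-- **The unit group: `U = ℤ_p^× ≅ μ_k(ℤ_p) × ℤ_p`** under the same unique-factorisation
hypothesis, by `(ζ, α) ↦ ζ·(1 + x)^α`: the units are exactly the elements `pⁿ·ω·(1 + x)^α` with
`n = 0` (take norms). For `p ≠ 2` this is Serre's `U = V × U₁`, `U₁ ≅ ℤ_p`.
[cite: Serre1973, Ch. II §3.1 Prop. 7 / §3.2 Prop. 8, Thm. 2 (proof)] -/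
theorem exists_unitsMulEquiv_of_existsUnique {x : ℤ_[p]} (hx : ‖x‖ < 1) {k : ℕ} [NeZero k]
    (H : ∀ y : ℚ_[p], y ≠ 0 → ∃! t : ℤ × ℤ_[p] × ℤ_[p], t.2.1 ^ k = 1 ∧
      y = (p : ℚ_[p]) ^ t.1 * (t.2.1 : ℚ_[p]) * (PadicInt.mahlerSeries (fun n => x ^ n) t.2.2 : ℚ_[p])) :
    ∃ e : (rootsOfUnity k ℤ_[p]) × Multiplicative ℤ_[p] ≃* ℤ_[p]ˣ,
      ∀ (ζ : rootsOfUnity k ℤ_[p]) (α : ℤ_[p]),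
        ((e (ζ, Multiplicative.ofAdd α) : ℤ_[p]ˣ) : ℤ_[p]) =
          ((ζ : ℤ_[p]ˣ) : ℤ_[p]) * PadicInt.mahlerSeries (fun n => x ^ n) α := by
  have hp0 : (p : ℚ_[p]) ≠ 0 := by exact_mod_cast hp.out.ne_zero
  -- the value of `(ζ, α)` in `ℤ_p`, a unit
  set g : (rootsOfUnity k ℤ_[p]) × Multiplicative ℤ_[p] → ℤ_[p] := fun t =>
    ((t.1 : ℤ_[p]ˣ) : ℤ_[p]) * PadicInt.mahlerSeries (fun n => x ^ n) t.2.toAdd with hg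
  have hgu : ∀ t, IsUnit (g t) := fun t => (t.1 : ℤ_[p]ˣ).isUnit.mul (isUnit_binomialPower hx _)
  have hgmul : ∀ s t, g (s * t) = g s * g t := by
    intro s t
    simp only [hg, Prod.fst_mul, Prod.snd_mul, toAdd_mul, Subgroup.coe_mul, Units.val_mul,
      binomialPower_add hx]
    ring
  let Ψ : (rootsOfUnity k ℤ_[p]) × Multiplicative ℤ_[p] →* ℤ_[p]ˣ :=
    MonoidHom.mk' (fun t => (hgu t).unit) (fun s t => Units.ext (by simp [hgmul]))
  have hΨ : ∀ t, ((Ψ t : ℤ_[p]ˣ) : ℤ_[p]) = g t := fun t => (hgu t).unit_spec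
  have hmem : ∀ ζ : rootsOfUnity k ℤ_[p], ((ζ : ℤ_[p]ˣ) : ℤ_[p]) ^ k = 1 :=
    fun ζ => (mem_rootsOfUnity' k _).1 ζ.2
  -- in `ℚ_p`, `g (ζ, α) = p⁰·ζ·(1 + x)^α`
  have hgQ : ∀ t, (g t : ℚ_[p]) = (p : ℚ_[p]) ^ (0 : ℤ) * (((t.1 : ℤ_[p]ˣ) : ℤ_[p]) : ℚ_[p]) *
      (PadicInt.mahlerSeries (fun n => x ^ n) t.2.toAdd : ℚ_[p]) := fun t => by
    rw [zpow_zero, one_mul, hg, PadicInt.coe_mul]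
  have hinj : Function.Injective Ψ := by
    intro s t hst
    have hy : g s = g t := by rw [← hΨ, ← hΨ, hst]
    have hg0 : (g s : ℚ_[p]) ≠ 0 := PadicInt.coe_ne_zero.2 (hgu s).ne_zero
    obtain ⟨t₀, -, huniq⟩ := H (g s) hg0
    have hs' := huniq (0, ((s.1 : ℤ_[p]ˣ) : ℤ_[p]), s.2.toAdd) ⟨hmem _, hgQ s⟩
    have ht' := huniq (0, ((t.1 : ℤ_[p]ˣ) : ℤ_[p]), t.2.toAdd) ⟨hmem _, by rw [hy]; exact hgQ t⟩
    have hst' := hs'.trans ht'.symm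
    simp only [Prod.mk.injEq, true_and] at hst'
    exact Prod.ext (Subtype.ext (Units.ext hst'.1)) (Multiplicative.toAdd.injective hst'.2)
  have hsurj : Function.Surjective Ψ := by
    intro u
    obtain ⟨⟨n, ω, α⟩, ⟨hω, hu⟩, -⟩ := H ((u : ℤ_[p]) : ℚ_[p]) (PadicInt.coe_ne_zero.2 u.ne_zero)
    dsimp only at hω hu
    -- norms force `n = 0`
    have hωu : IsUnit ω := IsUnit.of_pow_eq_one hω (NeZero.ne k)
    have hn : n = 0 := by
      have h1 : ‖((u : ℤ_[p]) : ℚ_[p])‖ = 1 := by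
        rw [← PadicInt.norm_def]; exact PadicInt.isUnit_iff.1 u.isUnit
      rw [hu, norm_mul, norm_mul, norm_zpow, Padic.norm_p, ← PadicInt.norm_def, ← PadicInt.norm_def,
        PadicInt.isUnit_iff.1 hωu, PadicInt.isUnit_iff.1 (isUnit_binomialPower hx α), mul_one,
        mul_one, inv_zpow', zpow_eq_one_iff_right₀ (by positivity)
          (by exact_mod_cast hp.out.one_lt.ne')] at h1
      omega
    refine ⟨(rootsOfUnity.mkOfPowEq ω hω, Multiplicative.ofAdd α), Units.ext ?_⟩
    apply Subtype.val_injective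
    rw [hΨ, hu, hn, zpow_zero, one_mul, hg, PadicInt.coe_mul]
    simp
  refine ⟨MulEquiv.ofBijective Ψ ⟨hinj, hsurj⟩, fun ζ α => ?_⟩
  rw [MulEquiv.ofBijective_apply, hΨ]
  simp [hg]

/-! ## §2. The explicit isomorphisms `ℤ × μ_{p−1} × ℤ_p ≅ ℚ_p^*` (`p ≠ 2`) and `ℤ × μ₂ × ℤ₂ ≅ ℚ_2^*` -/

/-- **`ℚ_p^* ≅ ℤ × μ_{p−1} × ℤ_p` for `p ≠ 2`**, by `(n, ζ, α) ↦ pⁿ·ζ·(1 + p)^α`.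
[cite: Serre1973, Ch. II §3.2 Thm. 2] [cite: NeukirchANT1999, Ch. II Prop. (5.7)(i)] -/
theorem exists_mulEquiv_zpow_mul_rootOfUnity_mul_binomialPower (hp2 : p ≠ 2) :
    ∃ e : Multiplicative ℤ × (rootsOfUnity (p - 1) ℤ_[p]) × Multiplicative ℤ_[p] ≃* ℚ_[p]ˣ,
      ∀ (n : ℤ) (ζ : rootsOfUnity (p - 1) ℤ_[p]) (α : ℤ_[p]),
        ((e (Multiplicative.ofAdd n, ζ, Multiplicative.ofAdd α) : ℚ_[p]ˣ) : ℚ_[p]) =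
          (p : ℚ_[p]) ^ n * (((ζ : ℤ_[p]ˣ) : ℤ_[p]) : ℚ_[p]) *
            (PadicInt.mahlerSeries (fun n => (p : ℤ_[p]) ^ n) α : ℚ_[p]) := by
  haveI : NeZero (p - 1) := ⟨(Nat.sub_pos_of_lt hp.out.one_lt).ne'⟩
  have hplt : ‖(p : ℤ_[p])‖ < 1 := by
    rw [PadicInt.norm_p]; exact inv_lt_one_of_one_lt₀ (by exact_mod_cast hp.out.one_lt)
  exact exists_mulEquiv_of_existsUnique hplt
    (fun y hy => existsUnique_eq_zpow_mul_rootOfUnity_mul_binomialPower hp2 y hy)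

/-- In `ℤ₂`, `ω² = 1 ↔ ω = ±1`. [folklore] -/
private theorem sq_eq_one_iff_two {ω : ℤ_[2]} : ω ^ 2 = 1 ↔ ω = 1 ∨ ω = -1 := by
  rw [sq, mul_self_eq_one_iff]

/-- **`ℚ_2^* ≅ ℤ × μ₂ × ℤ₂`**, by `(n, ζ, α) ↦ 2ⁿ·ζ·5^α` (`μ₂ = {±1}`, `5^α = (1 + 4)^α`).
[cite: Serre1973, Ch. II §3.2 Thm. 2] [cite: NeukirchANT1999, Ch. II Prop. (5.7)(i)] -/
theorem exists_mulEquiv_zpow_mul_sign_mul_five_pow :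
    ∃ e : Multiplicative ℤ × (rootsOfUnity 2 ℤ_[2]) × Multiplicative ℤ_[2] ≃* ℚ_[2]ˣ,
      ∀ (n : ℤ) (ζ : rootsOfUnity 2 ℤ_[2]) (α : ℤ_[2]),
        ((e (Multiplicative.ofAdd n, ζ, Multiplicative.ofAdd α) : ℚ_[2]ˣ) : ℚ_[2]) =
          (2 : ℚ_[2]) ^ n * (((ζ : ℤ_[2]ˣ) : ℤ_[2]) : ℚ_[2]) *
            (PadicInt.mahlerSeries (fun n => (4 : ℤ_[2]) ^ n) α : ℚ_[2]) := by
  have h4lt : ‖(4 : ℤ_[2])‖ < 1 := by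
    rw [show (4 : ℤ_[2]) = ((2 : ℕ) : ℤ_[2]) ^ 2 by norm_num, PadicInt.norm_p_pow]; norm_num
  have H : ∀ y : ℚ_[2], y ≠ 0 → ∃! t : ℤ × ℤ_[2] × ℤ_[2], t.2.1 ^ 2 = 1 ∧
      y = ((2 : ℕ) : ℚ_[2]) ^ t.1 * (t.2.1 : ℚ_[2]) *
        (PadicInt.mahlerSeries (fun n => (4 : ℤ_[2]) ^ n) t.2.2 : ℚ_[2]) := by
    intro y hy
    rw [Nat.cast_ofNat]
    exact (existsUnique_congr fun t => by rw [sq_eq_one_iff_two]).1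
      (existsUnique_eq_zpow_mul_sign_mul_five_pow y hy)
  obtain ⟨e, he⟩ := exists_mulEquiv_of_existsUnique h4lt H
  exact ⟨e, fun n ζ α => by rw [he n ζ α, Nat.cast_ofNat]⟩

/-- **`U = ℤ_p^× ≅ μ_{p−1} × ℤ_p` for `p ≠ 2`** (`U = V × U₁`, `U₁ = (1 + p)^{ℤ_p}`), by
`(ζ, α) ↦ ζ·(1 + p)^α`. [cite: Serre1973, Ch. II §3.1 Prop. 7 / §3.2 Prop. 8] -/
theorem exists_unitsMulEquiv_rootOfUnity_mul_binomialPower (hp2 : p ≠ 2) :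
    ∃ e : (rootsOfUnity (p - 1) ℤ_[p]) × Multiplicative ℤ_[p] ≃* ℤ_[p]ˣ,
      ∀ (ζ : rootsOfUnity (p - 1) ℤ_[p]) (α : ℤ_[p]),
        ((e (ζ, Multiplicative.ofAdd α) : ℤ_[p]ˣ) : ℤ_[p]) =
          ((ζ : ℤ_[p]ˣ) : ℤ_[p]) * PadicInt.mahlerSeries (fun n => (p : ℤ_[p]) ^ n) α := by
  haveI : NeZero (p - 1) := ⟨(Nat.sub_pos_of_lt hp.out.one_lt).ne'⟩
  have hplt : ‖(p : ℤ_[p])‖ < 1 := by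
    rw [PadicInt.norm_p]; exact inv_lt_one_of_one_lt₀ (by exact_mod_cast hp.out.one_lt)
  exact exists_unitsMulEquiv_of_existsUnique hplt
    (fun y hy => existsUnique_eq_zpow_mul_rootOfUnity_mul_binomialPower hp2 y hy)

/-- **`U = ℤ_2^× ≅ μ₂ × ℤ_2`** (`U = U₁ = {±1} × U₂`, `U₂ = 5^{ℤ_2}`), by `(ζ, α) ↦ ζ·5^α`.
[cite: Serre1973, Ch. II §3.2 Prop. 8] -/
theorem exists_unitsMulEquiv_sign_mul_five_pow :
    ∃ e : (rootsOfUnity 2 ℤ_[2]) × Multiplicative ℤ_[2] ≃* ℤ_[2]ˣ,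
      ∀ (ζ : rootsOfUnity 2 ℤ_[2]) (α : ℤ_[2]),
        ((e (ζ, Multiplicative.ofAdd α) : ℤ_[2]ˣ) : ℤ_[2]) =
          ((ζ : ℤ_[2]ˣ) : ℤ_[2]) * PadicInt.mahlerSeries (fun n => (4 : ℤ_[2]) ^ n) α := by
  have h4lt : ‖(4 : ℤ_[2])‖ < 1 := by
    rw [show (4 : ℤ_[2]) = ((2 : ℕ) : ℤ_[2]) ^ 2 by norm_num, PadicInt.norm_p_pow]; norm_num
  have H : ∀ y : ℚ_[2], y ≠ 0 → ∃! t : ℤ × ℤ_[2] × ℤ_[2], t.2.1 ^ 2 = 1 ∧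
      y = ((2 : ℕ) : ℚ_[2]) ^ t.1 * (t.2.1 : ℚ_[2]) *
        (PadicInt.mahlerSeries (fun n => (4 : ℤ_[2]) ^ n) t.2.2 : ℚ_[2]) := by
    intro y hy
    rw [Nat.cast_ofNat]
    exact (existsUnique_congr fun t => by rw [sq_eq_one_iff_two]).1
      (existsUnique_eq_zpow_mul_sign_mul_five_pow y hy)
  exact exists_unitsMulEquiv_of_existsUnique h4lt H

/-! ## §3. `μ_m(ℤ_p) ≅ ℤ/mℤ` for `m ∣ p − 1` -/

/-- The `m`-th roots of unity of `ℤ_p`, `m ∣ p − 1`, form a cyclic group of order `m`: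
`μ_m(ℤ_p) ≅ ℤ/mℤ` (a primitive `m`-th root exists by Hensel, `padicInt_exists_isPrimitiveRoot_of_dvd`).
[cite: Serre1973, Ch. II §3.1 Prop. 7 / §3.2 Thm. 2 ("`V` is cyclic of order `p − 1`")] -/
theorem nonempty_rootsOfUnity_mulEquiv_zmod {m : ℕ} (hm : m ∣ p - 1) :
    Nonempty (rootsOfUnity m ℤ_[p] ≃* Multiplicative (ZMod m)) := by
  have hp1 : p - 1 ≠ 0 := (Nat.sub_pos_of_lt hp.out.one_lt).ne'
  have hm0 : m ≠ 0 := fun h => hp1 (Nat.eq_zero_of_zero_dvd (h ▸ hm))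
  haveI : NeZero m := ⟨hm0⟩
  obtain ⟨ζ, hζ⟩ := padicInt_exists_isPrimitiveRoot_of_dvd hm
  have h1 : Nat.card (rootsOfUnity m ℤ_[p]) = m := hζ.card_rootsOfUnity
  have h2 : Nat.card (Multiplicative (ZMod m)) = m := by
    simp [Nat.card_eq_fintype_card, ZMod.card]
  exact ⟨mulEquivOfCyclicCardEq (h1.trans h2.symm)⟩

/-- `μ₂(ℤ₂) = {±1} ≅ ℤ/2ℤ`. [cite: Serre1973, Ch. II §3.2 Thm. 2] -/
theorem nonempty_rootsOfUnity_two_mulEquiv_zmod :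
    Nonempty (rootsOfUnity 2 ℤ_[2] ≃* Multiplicative (ZMod 2)) := by
  have hζ : IsPrimitiveRoot (-1 : ℤ_[2]) 2 := IsPrimitiveRoot.neg_one 0 (by norm_num)
  have h1 : Nat.card (rootsOfUnity 2 ℤ_[2]) = 2 := hζ.card_rootsOfUnity
  have h2 : Nat.card (Multiplicative (ZMod 2)) = 2 := by
    simp [Nat.card_eq_fintype_card, ZMod.card]
  exact ⟨mulEquivOfCyclicCardEq (h1.trans h2.symm)⟩

/-! ## §4. The printed statements -/

/-- **Serre, Ch. II §3.2 Theorem 2 (`p ≠ 2`): the group `ℚ_p^*` is isomorphic to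
`ℤ × ℤ/(p−1)ℤ × ℤ_p`** (Neukirch (5.7)(i) with `K = ℚ_p`: `q = p`, `a = 0`, `d = 1`).
[cite: Serre1973, Ch. II §3.2 Thm. 2] [cite: NeukirchANT1999, Ch. II Prop. (5.7)(i)] -/
theorem nonempty_units_padic_mulEquiv (hp2 : p ≠ 2) :
    Nonempty (ℚ_[p]ˣ ≃* Multiplicative ℤ × Multiplicative (ZMod (p - 1)) × Multiplicative ℤ_[p]) := by
  obtain ⟨e, -⟩ := exists_mulEquiv_zpow_mul_rootOfUnity_mul_binomialPower hp2
  obtain ⟨f⟩ := nonempty_rootsOfUnity_mulEquiv_zmod (p := p) (dvd_refl (p - 1))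
  exact ⟨e.symm.trans (MulEquiv.prodCongr (MulEquiv.refl _) (MulEquiv.prodCongr f (MulEquiv.refl _)))⟩

/-- **Serre, Ch. II §3.2 Theorem 2 (`p = 2`): the group `ℚ_2^*` is isomorphic to `ℤ × ℤ/2ℤ × ℤ_2`**
(Neukirch (5.7)(i) with `K = ℚ_2`: `q − 1 = 1`, `a = 1`, `d = 1`).
[cite: Serre1973, Ch. II §3.2 Thm. 2] [cite: NeukirchANT1999, Ch. II Prop. (5.7)(i)] -/
theorem nonempty_units_padicTwo_mulEquiv :
    Nonempty (ℚ_[2]ˣ ≃* Multiplicative ℤ × Multiplicative (ZMod 2) × Multiplicative ℤ_[2]) := by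
  obtain ⟨e, -⟩ := exists_mulEquiv_zpow_mul_sign_mul_five_pow
  obtain ⟨f⟩ := nonempty_rootsOfUnity_two_mulEquiv_zmod
  exact ⟨e.symm.trans (MulEquiv.prodCongr (MulEquiv.refl _) (MulEquiv.prodCongr f (MulEquiv.refl _)))⟩

/-- **`U = ℤ_p^× ≅ ℤ/(p−1)ℤ × ℤ_p` for `p ≠ 2`** (`U = V × U₁`, `V` cyclic of order `p − 1`,
`U₁ ≅ ℤ_p`). [cite: Serre1973, Ch. II §3.1 Prop. 7, Cor. / §3.2 Prop. 8] -/
theorem nonempty_units_padicInt_mulEquiv (hp2 : p ≠ 2) :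
    Nonempty (ℤ_[p]ˣ ≃* Multiplicative (ZMod (p - 1)) × Multiplicative ℤ_[p]) := by
  obtain ⟨e, -⟩ := exists_unitsMulEquiv_rootOfUnity_mul_binomialPower hp2
  obtain ⟨f⟩ := nonempty_rootsOfUnity_mulEquiv_zmod (p := p) (dvd_refl (p - 1))
  exact ⟨e.symm.trans (MulEquiv.prodCongr f (MulEquiv.refl _))⟩

/-- **`U = ℤ_2^× ≅ ℤ/2ℤ × ℤ_2`** (`U₁ = {±1} × U₂`, `U₂ ≅ ℤ_2`). [cite: Serre1973, Ch. II §3.2 Prop. 8] -/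
theorem nonempty_units_padicIntTwo_mulEquiv :
    Nonempty (ℤ_[2]ˣ ≃* Multiplicative (ZMod 2) × Multiplicative ℤ_[2]) := by
  obtain ⟨e, -⟩ := exists_unitsMulEquiv_sign_mul_five_pow
  obtain ⟨f⟩ := nonempty_rootsOfUnity_two_mulEquiv_zmod
  exact ⟨e.symm.trans (MulEquiv.prodCongr f (MulEquiv.refl _))⟩

end Literature.NumberTheory.LocalFields
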